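import Summits.QuantumFields.YangMills.Theorems.ColdStartUniversalityLindebergSwapFreeStubs
import Summits.QuantumFields.YangMills.Theorems.TransportPerturbationWindowSemigroup
import Summits.QuantumFields.YangMills.Theorems.TransportPerturbationSolutionFamily
import Summits.QuantumFields.YangMills.Theorems.ColdStartUniversalityLatticeLangevinLawUnique
import Summits.QuantumFields.YangMills.Theorems.ColdStartUniversalityUniformColdStartMixingIntegrand
import HarnessLib

/-!
# Crux `ColdStartContinuumCauchy` (stmt-QuantumFields-24810, route `ColdStartUniversality`), LINE 3 «lindeberg_swap»:
# stub `stub_lindebergTelescoping` — THE LINDEBERG / TROTTER TELESCOPING BOOKKEEPING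

The registered stub `LindebergTelescoping` of the «lindeberg_swap» skeleton (sha 5aa38edd…; its vocabulary `obsK`, `cesaro`,
`IsColdStartSol`, `IsSolFamily`, `stepDown`, `InCls`, the node Props and the `__Registered.*` aliases are the tree's since p665853,
`…ColdStartUniversalityLindebergSwapFreeStubs`):

  `CesaroLawUnique → StepDownCompat → OneWindowSwap → ScalePropagation → LoopStringLipschitz → GeomIncrements`.

Proof (classical hybrid argument, [folklore]; the Markov-chain form of Lindeberg's replacement scheme / Trotter's product
telescoping).  Fix `F, γ, os, T`; let `A` be the scale-weighted Lipschitz constant of the unit loop string (`LoopStringLipschitz`),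
`(C_sw, r, τ₀)` the one-window swap data and `C_sp` the class-propagation constant on `[0, T]`; put `n := ⌈T/τ₀⌉₊ + 1` and
`C := n · C_sw · C_sp · A`.  Given `K`, a fine (step `K+1`) cold-start solution `U'` on `(Ω', P')` and a coarse (step `K`)
cold-start solution `U` on `(Ω, P)`, take a jointly measurable coarse solution family `V` on a third space `(Ω₂, P₂)`
(`TransportPerturbation.solutionFamily_proof`, item 26920) with transition operators `P_u g := markovTransition V P₂ (u/ε_K) g`.
For a physical time `s ∈ [0, T]` and the equal windows `t_k = k s / n` (length `s/n ≤ τ₀`) the hybrids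
`H_k := E'[(P_{s - t_k} g)(stepDown U'(t_k/ε_{K+1}))]`, `g := obsK K os`, satisfy
* `H_n = E'[obsK (K+1) os (U'(s/ε_{K+1}))]` (`P_0 = id` as `V x 0 = x`; `StepDownCompat` (i));
* `H_0 = E[g(U(s/ε_K))]` (`U'(0) = 1`, `stepDown 1 = 1` by `StepDownCompat` (ii), and UNIQUENESS IN LAW of cold-start solutions
  across spaces, `coldStart_lawUnique`, applied to `U` and `V 1`);
* `|H_{k+1} - H_k| ≤ C_sw (C_sp A) r^K`: Chapman–Kolmogorov `P_{s-t_k} = P_{s/n} P_{s-t_{k+1}}` (`markovTransition_add`, from THE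
  transition kernels of the SZZ dynamics and `chapmanKolmogorov_szz`), `P_{s-t_{k+1}} g ∈ 𝒢_K(C_sp A)` (`ScalePropagation`) and
  `OneWindowSwap` on the window `[t_k, t_{k+1}]`.
Telescoping gives `|E' obsK(K+1)(U'(s)) − E obsK K (U(s))| ≤ C r^K` for every `s ∈ [0,T]`, and the Cesàro means inherit the bound
(`integrandRegular`: the integrands are interval-integrable; `intervalIntegral.norm_integral_le_of_norm_le_const`).
`CesaroLawUnique` is not needed beyond what `coldStart_lawUnique` already gives and is carried as an idle hypothesis of the
registered signature.

Seat `ym-line-csu-p1` (g9), `--supports stmt-QuantumFields-24810`.  THEOREMS ONLY, no definition, no sorry.  HONEST FRAMING: this is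
the L-sized bookkeeping stub; LINE 3's content is `stub_oneWindowSwap` / `stub_scalePropagation` (XL, OPEN) and the rung
`stub_shortWindowSwap`; no crux, rung (CSU is a RECORD-rung ladder, not Clay) or summit is proved; the Yang–Mills mass gap is NOT proved.
-/

set_option autoImplicit false

noncomputable section

namespace Summit.QuantumFields.YangMills.Cruxes.ColdStartContinuumCauchy.LindebergSwap

open scoped BigOperators NNReal
open MeasureTheory Filter
open Literature.MathematicalPhysics.QuantumFieldTheory
open Literature.MathematicalPhysics.QuantumFieldTheory.Balaban1983to89
open Literature.MathematicalPhysics.QuantumLattice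

/-- **Telescoping**: if consecutive terms of `H` differ by at most `B` on `k < n`, then `|H n - H 0| ≤ n B`. [folklore] -/
theorem abs_sub_le_mul_of_succ_le (H : ℕ → ℝ) (B : ℝ) (n : ℕ) (h : ∀ k < n, |H (k + 1) - H k| ≤ B) :
    |H n - H 0| ≤ n * B := by
  induction n with
  | zero => simp
  | succ m ih =>
    have h1 := h m (Nat.lt_succ_self m)
    have h2 := ih fun k hk => h k (Nat.lt_succ_of_lt hk)
    calc |H (m + 1) - H 0| = |(H (m + 1) - H m) + (H m - H 0)| := by ring_nf
      _ ≤ |H (m + 1) - H m| + |H m - H 0| := abs_add_le _ _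
      _ ≤ B + m * B := add_le_add h1 h2
      _ = ((m + 1 : ℕ) : ℝ) * B := by push_cast; ring

/-- **The transition operator at time `0` of a solution family is the identity** (`V x 0 = x`, probability measure). [folklore] -/
theorem markovTransition_zero_of_start {X Ω : Type*} [MeasurableSpace Ω] (V : X → ℝ≥0 → Ω → X) (P : Measure Ω)
    [IsProbabilityMeasure P] (hV0 : ∀ x ω, V x 0 ω = x) (g : X → ℝ) : markovTransition V P 0 g = g := by
  funext x
  simp [markovTransition, hV0 x]

/-- **Equal windows fit**: for `0 ≤ s ≤ T`, `0 < τ₀` and `n = ⌈T/τ₀⌉₊ + 1`, the window length `s / n` lies in `[0, τ₀]`. [folklore] -/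
theorem window_length_le {s T τ₀ : ℝ} (hs0 : 0 ≤ s) (hsT : s ≤ T) (hτ₀ : 0 < τ₀) :
    0 ≤ s / (⌈T / τ₀⌉₊ + 1 : ℕ) ∧ s / (⌈T / τ₀⌉₊ + 1 : ℕ) ≤ τ₀ := by
  have hn : (0 : ℝ) < (⌈T / τ₀⌉₊ + 1 : ℕ) := by positivity
  refine ⟨div_nonneg hs0 hn.le, ?_⟩
  rw [div_le_iff₀ hn]
  have hceil : T / τ₀ ≤ (⌈T / τ₀⌉₊ : ℝ) := Nat.le_ceil _
  have hT : T ≤ τ₀ * (⌈T / τ₀⌉₊ : ℝ) := by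
    rw [div_le_iff₀' hτ₀] at hceil
    exact hceil
  calc s ≤ T := hsT
    _ ≤ τ₀ * (⌈T / τ₀⌉₊ : ℝ) := hT
    _ ≤ τ₀ * ((⌈T / τ₀⌉₊ + 1 : ℕ) : ℝ) := by
        gcongr
        exact_mod_cast Nat.le_succ _
    _ = τ₀ * (⌈T / τ₀⌉₊ + 1 : ℕ) := rfl

/-- **`LindebergTelescoping` (registered stub `stub_lindebergTelescoping` of LINE 3 «lindeberg_swap», stmt-QuantumFields-24810)**:
law uniqueness + transport compatibility + one-window swap + class propagation + loop string in the class ⇒ geometric increments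
of the cold-start Cesàro values across consecutive cut-offs.  Hybrid telescoping over `⌈T/τ₀⌉₊ + 1` equal windows with the
Markov property (Chapman–Kolmogorov) of the coarse SZZ transition operators. [folklore] -/
theorem stub_lindebergTelescoping : __Registered.stub_lindebergTelescoping := by
  rintro - hSD hSW hSP hLip F γ hγ os T hT
  classical
  obtain ⟨A, hA0, hcls⟩ := hLip F os
  obtain ⟨Csw, r, τ₀, hCsw, hr0, hr1, hτ₀, hsw⟩ := hSW F γ hγ T hT
  obtain ⟨Csp, hCsp, hsp⟩ := hSP F γ hγ T hT
  -- number of windows and the constant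
  set n : ℕ := ⌈T / τ₀⌉₊ + 1 with hn_def
  have hn_pos : (0 : ℝ) < n := by rw [hn_def]; positivity
  have hn_ne : (n : ℝ) ≠ 0 := hn_pos.ne'
  refine ⟨n * (Csw * (Csp * A)), r, hr0, hr1, ?_⟩
  intro K Ω' mΩ' P' hP' W' hW' U' hU' Ω mΩ P hP W hW U hU
  obtain ⟨hU'0, hU'sol⟩ := hU'
  obtain ⟨hU0, hUsol⟩ := hU
  -- a jointly measurable coarse solution family on a third space
  obtain ⟨Ω₂, mΩ₂, P₂, hP₂, W₂, hW₂, V, hV⟩ :=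
    Summit.QuantumFields.YangMills.Theorems.TransportPerturbation.solutionFamily_proof F γ hγ K
  have hVfam : IsSolFamily F γ K P₂ W₂ hW₂ V := hV
  have hV' : ∀ x, (∀ ω, V x 0 ω = x) ∧
      (latticeLangevinDynamics (fundamentalLatticeRep 2) ((γ * (F.P K).eps)⁻¹ / 2)).IsSolution (fundamentalRep (Fin 2))
        hW₂.natFiltration P₂ W₂ (V x) := fun x => hV.1 x
  have hVm : ∀ t : ℝ≥0, Measurable fun p : GaugeConfig 3 ((F.P K).sitesPerDir 0) G2 × Ω₂ => V p.1 t p.2 := hV.2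
  -- abbreviations
  set ε : ℝ := (F.P K).eps with hε_def
  set ε' : ℝ := (F.P (K + 1)).eps with hε'_def
  have hε : 0 < ε := (F.P K).eps_pos
  set g : GaugeConfig 3 ((F.P K).sitesPerDir 0) G2 → ℝ := obsK F K os with hg_def
  have hgcls : InCls F K A g := hcls K
  have hgm : Measurable g := hgcls.1
  have hgb : ∀ u, |g u| ≤ 1 := hgcls.2.1
  -- the swap bound on one window, for the propagated observable
  have hB0 : 0 ≤ Csw * (Csp * A) * r ^ K := by positivity
  /- pointwise-in-time estimate -/
  have hpt : ∀ s : ℝ, 0 ≤ s → s ≤ T →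
      |(∫ ω, obsK F (K + 1) os (U' (s / ε').toNNReal ω) ∂P') - ∫ ω, g (U (s / ε).toNNReal ω) ∂P|
        ≤ n * (Csw * (Csp * A) * r ^ K) := by
    intro s hs0 hsT
    obtain ⟨hw0, hwτ⟩ := window_length_le (T := T) hs0 hsT hτ₀
    rw [← hn_def] at hw0 hwτ
    -- window points `t k = k * (s / n)`
    have ht_le : ∀ k : ℕ, k ≤ n → (k : ℝ) * (s / n) ≤ s := by
      intro k hk
      have hk' : (k : ℝ) ≤ n := by exact_mod_cast hk
      calc (k : ℝ) * (s / n) ≤ n * (s / n) := by gcongr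
        _ = s := by field_simp
    have ht_nn : ∀ k : ℕ, 0 ≤ (k : ℝ) * (s / n) := fun k => by positivity
    -- the hybrids
    have key := abs_sub_le_mul_of_succ_le
      (fun k : ℕ => ∫ ω, markovTransition V P₂ ((s - (k : ℝ) * (s / n)) / ε).toNNReal g
        (stepDown F K (U' (((k : ℝ) * (s / n)) / ε').toNNReal ω)) ∂P')
      (Csw * (Csp * A) * r ^ K) n ?_
    · -- endpoints
      have hn_end : ((n : ℝ) * (s / n)) = s := by field_simp
      have h0_end : ((0 : ℕ) : ℝ) * (s / n) = 0 := by simp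
      simp only [hn_end, h0_end, sub_self, zero_div, Real.toNNReal_zero, sub_zero] at key
      haveI := hP₂
      haveI := hP'
      haveI := hP
      rw [markovTransition_zero_of_start V P₂ (fun x => (hV' x).1) g] at key
      -- `H_n = f'(s)` by transport compatibility; `H_0 = f(s)` by `U'(0) = 1`, `stepDown 1 = 1` and law uniqueness
      have hHn : (∫ ω, g (stepDown F K (U' (s / ε').toNNReal ω)) ∂P') =
          ∫ ω, obsK F (K + 1) os (U' (s / ε').toNNReal ω) ∂P' := by
        refine integral_congr_ae (ae_of_all _ fun ω => ?_)
        simp only [hg_def]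
        exact ((hSD F K).1 os _).symm
      have hH0 : (∫ ω, markovTransition V P₂ (s / ε).toNNReal g (stepDown F K (U' 0 ω)) ∂P') =
          ∫ ω, g (U (s / ε).toNNReal ω) ∂P := by
        have h1 : ∀ ω, stepDown F K (U' 0 ω) = fun _ => 1 := fun ω => by rw [hU'0 ω]; exact (hSD F K).2
        simp only [h1, integral_const, smul_eq_mul, probReal_univ, one_mul]
        -- law uniqueness: law of `U` at lattice time `s/ε` = law of `V 1` there
        have hmU : Measurable (U (s / ε).toNNReal) := (hUsol.adapted _).mono (hW.natFiltration.le _) le_rfl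
        have hmV : Measurable (V (fun _ => 1) (s / ε).toNNReal) :=
          ((hV' _).2.adapted _).mono (hW₂.natFiltration.le _) le_rfl
        have hlaw := Summit.QuantumFields.YangMills.Theorems.ColdStartUniversality.coldStart_lawUnique
          ((F.P K).sitesPerDir 0) ((γ * (F.P K).eps)⁻¹ / 2) Ω mΩ P hP W hW U Ω₂ mΩ₂ P₂ hP₂ W₂ hW₂ (V fun _ => 1)
          hU0 hUsol (hV' _).1 (hV' _).2 (s / ε).toNNReal
        show (∫ ω, g (V (fun _ => 1) (s / ε).toNNReal ω) ∂P₂) = ∫ ω, g (U (s / ε).toNNReal ω) ∂P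
        rw [← integral_map hmU.aemeasurable hgm.aestronglyMeasurable,
          ← integral_map hmV.aemeasurable hgm.aestronglyMeasurable, hlaw]
      rw [hHn, hH0] at key
      exact key
    · -- one window: Chapman–Kolmogorov + class propagation + the swap
      intro k hk
      have hk1 : k + 1 ≤ n := hk
      -- times
      have hu0 : 0 ≤ s - ((k + 1 : ℕ) : ℝ) * (s / n) := sub_nonneg.mpr (ht_le (k + 1) hk1)
      have huT : s - ((k + 1 : ℕ) : ℝ) * (s / n) ≤ T := by linarith [ht_nn (k + 1)]
      have hsplit : s - (k : ℝ) * (s / n) = s / n + (s - ((k + 1 : ℕ) : ℝ) * (s / n)) := by push_cast; ring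
      have hnext : (((k + 1 : ℕ) : ℝ) * (s / n)) = (k : ℝ) * (s / n) + s / n := by push_cast; ring
      have hwin : (k : ℝ) * (s / n) + s / n ≤ T := by rw [← hnext]; exact (ht_le (k + 1) hk1).trans hsT
      -- the propagated observable is in the class
      set gk := markovTransition V P₂ ((s - ((k + 1 : ℕ) : ℝ) * (s / n)) / ε).toNNReal g with hgk_def
      have hgk : InCls F K (Csp * A) gk := hsp K A g hgcls Ω₂ mΩ₂ P₂ hP₂ W₂ hW₂ V hVfam _ hu0 huT
      -- Chapman–Kolmogorov: `P_{s - t_k} g = P_{s/n} gk`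
      have hCK : markovTransition V P₂ ((s - (k : ℝ) * (s / n)) / ε).toNNReal g =
          markovTransition V P₂ ((s / n) / ε).toNNReal gk := by
        haveI := hP₂
        have hadd : ((s - (k : ℝ) * (s / n)) / ε).toNNReal =
            ((s / n) / ε).toNNReal + ((s - ((k + 1 : ℕ) : ℝ) * (s / n)) / ε).toNNReal := by
          rw [hsplit, add_div, Real.toNNReal_add (div_nonneg hw0 hε.le) (div_nonneg hu0 hε.le)]
        rw [hadd]
        exact (Summit.QuantumFields.YangMills.Theorems.TransportPerturbation.markovTransition_add hW₂ V hV' hVm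
          _ _ hgm hgb).1
      have hswap := hsw K Ω' mΩ' P' hP' W' hW' U' ⟨hU'0, hU'sol⟩ Ω₂ mΩ₂ P₂ hP₂ W₂ hW₂ V hVfam (Csp * A) gk hgk
        ((k : ℝ) * (s / n)) (s / n) (ht_nn k) hw0 hwτ hwin
      -- rewrite the two hybrids into the swap form
      show |(∫ ω, gk (stepDown F K (U' ((((k + 1 : ℕ) : ℝ) * (s / n)) / ε').toNNReal ω)) ∂P') -
          ∫ ω, markovTransition V P₂ ((s - (k : ℝ) * (s / n)) / ε).toNNReal g
            (stepDown F K (U' (((k : ℝ) * (s / n)) / ε').toNNReal ω)) ∂P'| ≤ Csw * (Csp * A) * r ^ K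
      rw [hCK, hnext]
      exact hswap
  /- Cesàro step -/
  have hi' : IntervalIntegrable (fun s : ℝ => ∫ ω, obsK F (K + 1) os (U' (s / ε').toNNReal ω) ∂P') volume 0 T :=
    (Summit.QuantumFields.YangMills.Theorems.ColdStartUniversality.integrandRegular F γ hγ os (K + 1) Ω' mΩ' P' hP' W'
      hW' U' hU'0 hU'sol).2.2 T
  have hi : IntervalIntegrable (fun s : ℝ => ∫ ω, g (U (s / ε).toNNReal ω) ∂P) volume 0 T :=
    (Summit.QuantumFields.YangMills.Theorems.ColdStartUniversality.integrandRegular F γ hγ os K Ω mΩ P hP W hW U hU0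
      hUsol).2.2 T
  have hdiff : cesaro F (K + 1) os T P' U' - cesaro F K os T P U =
      T⁻¹ * ∫ s in (0 : ℝ)..T, ((∫ ω, obsK F (K + 1) os (U' (s / ε').toNNReal ω) ∂P') -
        ∫ ω, g (U (s / ε).toNNReal ω) ∂P) := by
    rw [intervalIntegral.integral_sub hi' hi, mul_sub]
    rfl
  rw [hdiff, abs_mul, abs_of_pos (inv_pos.mpr hT)]
  have hbound := intervalIntegral.norm_integral_le_of_norm_le_const (a := (0 : ℝ)) (b := T)
    (f := fun s : ℝ => (∫ ω, obsK F (K + 1) os (U' (s / ε').toNNReal ω) ∂P') - ∫ ω, g (U (s / ε).toNNReal ω) ∂P)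
    (C := n * (Csw * (Csp * A) * r ^ K)) (fun s hs => by
      rw [Set.uIoc_of_le hT.le] at hs
      rw [Real.norm_eq_abs]
      exact hpt s hs.1.le hs.2)
  rw [sub_zero, abs_of_pos hT, Real.norm_eq_abs] at hbound
  calc T⁻¹ * |∫ s in (0 : ℝ)..T, ((∫ ω, obsK F (K + 1) os (U' (s / ε').toNNReal ω) ∂P') -
          ∫ ω, g (U (s / ε).toNNReal ω) ∂P)|
      ≤ T⁻¹ * (n * (Csw * (Csp * A) * r ^ K) * T) := by gcongr
    _ = n * (Csw * (Csp * A)) * r ^ K := by field_simp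

end Summit.QuantumFields.YangMills.Cruxes.ColdStartContinuumCauchy.LindebergSwap

end
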